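import Literature.AnabelianGeometry.AbsoluteAnabelian.AbsTopIII.AutHolLogFrobeniusAssembly
import Mathlib.CategoryTheory.SingleObj
import Mathlib.CategoryTheory.PUnit
import Mathlib.Algebra.Group.Nat.TypeTags
import HarnessLib

/-!
# [AbsTopIII] Cor 3.6 / Cor 4.5 over abstract data: the hypothesis lists are CONSISTENT (kernel witness)

Mochizuki, *Topics in Absolute Anabelian Geometry III*, Corollary 3.6 (i)–(v) pp. 78–80 and
Corollary 4.5 (i)–(v) pp. 107–109 of the author's kurims manuscript (lit key `paper:url-5493eb38cbb7`;
bib key `MochizukiAbsTopIII2015`).  PROOF-ONLY file (abc-iut cell; sub-DAG `AbsTopIII:Cor4.5 (i)(iv)(v)`,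
NOTE (c) of plan/L4/SUBDAG-AbsTopIII-Cor45.md; seat abc-iut-w5-d210).  No notion is declared.

The tree proves Cor. 3.6 (`LogFrobeniusData.logFrobeniusCompatible_of`, abc-iut-L4-t5) and Cor. 4.5
(`AbsTopIII.cor_4_5_of_inputs`, abc-iut-w5-d210 over t5/t10) for EVERY abstract input datum
`Δ : LogFrobeniusData` satisfying a short list of hypotheses (orientation of `ι_×`, an object, the
Lemma-3.4 / Lemma-4.4 property, id-rigidity, the printed-case shape hypotheses of (ii)).  Since the
geometric INSTANCES of Def. 3.1 / Def. 4.1 are not yet constructed in the tree, the referee question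
"are these hypothesis lists jointly satisfiable at all, or do the two corollaries hold vacuously?"
had no kernel answer.  This file gives it: `cor_4_5_hypotheses_satisfiable` and
`cor_3_6_hypotheses_satisfiable` exhibit (inside the proofs; nothing is added to the library) a
log-Frobenius input datum of each orientation — first row, nexus, `ℰ`, `𝒜` the one-object discrete
category, `𝒩` the one-object category of the monoid `(ℕ, +)`, `ι_log,⋎ = 1`, `ι_× = 1` (Aut-holomorphic
orientation; the forbidden composite is `2 ≠ 0`) resp. `ι_× = 2` (MLF orientation; `1 ≠ 2`) — at which
ALL hypotheses of the assembly theorems hold SIMULTANEOUSLY, and records that the assembled conclusions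
`Cor_4_5 Δ τ` / `Δ.LogFrobeniusCompatible τ` are then inhabited.  (A toy, not the geometric data:
it certifies consistency of the abstract layer, nothing about Def. 4.1's categories.)

Refereed pre-IUT material; nothing here bears on [IUTchIII] Cor. 3.12 or takes a side; typed ≠ proved
for the geometric instance.
-/

namespace Literature.AnabelianGeometry.AbsoluteAnabelian.AbsTopIII

open _root_.CategoryTheory

/-- **The hypotheses of `cor_4_5_of_inputs` (Cor. 4.5 over abstract data) are jointly satisfiable**,
non-trivially in the sense that matters for (iv): there IS an input datum of Aut-holomorphic orientation
with an object of `LinHol`, the Lemma-4.4 property (every candidate composite `λ^×(a) ≫ ι_log ≫ ι_×`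
differs from the identity), id-rigid `X₁`, `𝒳` and rigid fully faithful `id_⋎`, together with coherent
first-row telecore data — and Cor. 4.5 (i)–(v) holds there (so the abstract corollary is not vacuous).
[cite: MochizukiAbsTopIII2015, Corollary 4.5 pp.107–109] -/
theorem cor_4_5_hypotheses_satisfiable :
    ∃ (Δ : LogFrobeniusData.{0}) (τ : Δ.TelecoreData) (ι : Δ.lamPf ⟶ Δ.lamTimes) (_a₀ : Δ.A),
      Δ.ιtimes = Sum.inr ι ∧ Lemma44Property ι ∧ IsIdRigid Δ.X₁ ∧ IsIdRigid Δ.X ∧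
      IsRigidFunctor Δ.toNexus ∧ Nonempty Δ.toNexus.FullyFaithful ∧
      (∀ x : Δ.X₁, Δ.toNexus.map (τ.η₁.hom.app x) =
        τ.e.hom.app (Δ.κ.obj (Δ.XtoE.obj (Δ.toNexus.obj x))) ≫ Δ.η.hom.app (Δ.toNexus.obj x)) ∧
      Literature.AnabelianGeometry.AbsoluteAnabelian.AbsTopIII.Cor_4_5 Δ τ := by
  -- the one-object categories: `P` (discrete) for the rows 1, 2, 4, 5, 6 and `N` (monoid `(ℕ,+)`) for row 3
  let L : Discrete PUnit.{1} ⥤ SingleObj (Multiplicative ℕ) :=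
    (Functor.const (Discrete PUnit.{1})).obj (SingleObj.star _)
  -- `ι_log = 1`, `ι_× = 1 : λ^∼ → λ^×`
  let one : L ⟶ L := Discrete.natTrans fun _ => (Multiplicative.ofAdd (1 : ℕ) : Multiplicative ℕ)
  let Δ : LogFrobeniusData.{0} :=
    { X₁ := Discrete PUnit.{1}, X := Discrete PUnit.{1}, toNexus := 𝟭 _, N := SingleObj (Multiplicative ℕ),
      E := Discrete PUnit.{1}, A := Discrete PUnit.{1},
      log := 𝟭 _, logIsoId := Iso.refl _,
      lamTimes := L, lamPf := L,
      ιlog := one, ιtimes := Sum.inr one,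
      XtoE := 𝟭 _, NtoE := (Functor.const (SingleObj (Multiplicative ℕ))).obj ⟨PUnit.unit⟩,
      lamTimes_NtoE := Functor.punit_ext' _ _, lamPf_NtoE := Functor.punit_ext' _ _,
      κ := 𝟭 _, AtoE := 𝟭 _, κ_equiv := inferInstance, κ_inv := Functor.punitExt _ _,
      φ := 𝟭 _, φ_equiv := inferInstance, η := Functor.punitExt _ _ }
  let τ : Δ.TelecoreData := { φ₁ := 𝟭 _, e := Functor.punitExt _ _, η₁ := Functor.punitExt _ _ }
  have hP : IsIdRigid (Discrete PUnit.{1}) :=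
    fun α => Iso.ext (NatTrans.ext (funext fun _ => Subsingleton.elim _ _))
  have h44 : Lemma44Property (Δ := Δ) one := by
    intro x a _ h
    -- the composite is `1 ≫ 1 ≫ 1 = 2` in `(ℕ,+)`, not the identity `0`
    have h' : (Multiplicative.ofAdd (1 : ℕ) : Multiplicative ℕ) * Multiplicative.ofAdd (1 : ℕ) * 1 = 1 := by
      simpa [Δ, L, one, ιlogApp, SingleObj.comp_as_mul, SingleObj.id_as_one, Discrete.natTrans] using h
    have h'' := congrArg Multiplicative.toAdd h'
    simp at h''
  refine ⟨Δ, τ, one, ⟨PUnit.unit⟩, rfl, h44, hP, hP, hP, ⟨Functor.FullyFaithful.id _⟩,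
    fun x => Subsingleton.elim _ _, ?_⟩
  exact cor_4_5_of_inputs τ (Functor.FullyFaithful.id _) (fun x => Subsingleton.elim _ _) one rfl
    ⟨PUnit.unit⟩ h44 hP hP hP

/-- **The hypotheses of `LogFrobeniusData.logFrobeniusCompatible_of` (Cor. 3.6 over abstract data,
abc-iut-L4-t5) are jointly satisfiable**: an input datum of MLF orientation (`ι_× : λ^× → λ^{×pf}`)
with the Lemma-3.4 property (`λ^×(a) ≫ ι_log ≠ ι_×` for every isomorphism `a`), a first-row object,
totally rigid `𝒟_{≤□}`, fully faithful `id_⋎` and coherent telecore data — at which the assembled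
Cor. 3.6 (`LogFrobeniusCompatible`) holds. [cite: MochizukiAbsTopIII2015, Corollary 3.6 pp.78–80] -/
theorem cor_3_6_hypotheses_satisfiable :
    ∃ (Δ : LogFrobeniusData.{0}) (τ : Δ.TelecoreData) (ι : Δ.lamTimes ⟶ Δ.lamPf) (_x₀ : Δ.X₁),
      Δ.ιtimes = Sum.inl ι ∧ Δ.Lemma34Property ι ∧
      (Δ.diagram.restrict ({a : LFVertex | a.row = 1} ∪ {LFVertex.nexus})).IsTotallyRigid ∧
      Nonempty Δ.toNexus.FullyFaithful ∧
      (∀ x : Δ.X₁, Δ.toNexus.map (τ.η₁.hom.app x) =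
        τ.e.hom.app (Δ.κ.obj (Δ.XtoE.obj (Δ.toNexus.obj x))) ≫ Δ.η.hom.app (Δ.toNexus.obj x)) ∧
      Δ.LogFrobeniusCompatible τ := by
  let L : Discrete PUnit.{1} ⥤ SingleObj (Multiplicative ℕ) :=
    (Functor.const (Discrete PUnit.{1})).obj (SingleObj.star _)
  -- `ι_log = 1`, `ι_× = 2 : λ^× → λ^{×pf}`
  let one : L ⟶ L := Discrete.natTrans fun _ => (Multiplicative.ofAdd (1 : ℕ) : Multiplicative ℕ)
  let two : L ⟶ L := Discrete.natTrans fun _ => (Multiplicative.ofAdd (2 : ℕ) : Multiplicative ℕ)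
  let Δ : LogFrobeniusData.{0} :=
    { X₁ := Discrete PUnit.{1}, X := Discrete PUnit.{1}, toNexus := 𝟭 _, N := SingleObj (Multiplicative ℕ),
      E := Discrete PUnit.{1}, A := Discrete PUnit.{1},
      log := 𝟭 _, logIsoId := Iso.refl _,
      lamTimes := L, lamPf := L,
      ιlog := one, ιtimes := Sum.inl two,
      XtoE := 𝟭 _, NtoE := (Functor.const (SingleObj (Multiplicative ℕ))).obj ⟨PUnit.unit⟩,
      lamTimes_NtoE := Functor.punit_ext' _ _, lamPf_NtoE := Functor.punit_ext' _ _,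
      κ := 𝟭 _, AtoE := 𝟭 _, κ_equiv := inferInstance, κ_inv := Functor.punitExt _ _,
      φ := 𝟭 _, φ_equiv := inferInstance, η := Functor.punitExt _ _ }
  let τ : Δ.TelecoreData := { φ₁ := 𝟭 _, e := Functor.punitExt _ _, η₁ := Functor.punitExt _ _ }
  have hP : IsIdRigid (Discrete PUnit.{1}) :=
    fun α => Iso.ext (NatTrans.ext (funext fun _ => Subsingleton.elim _ _))
  have h34 : Δ.Lemma34Property two := by
    intro x a _ h
    -- `λ^×(a) ≫ ι_log = 1` while `ι_× = 2`
    simp [Δ, L, one, two, SingleObj.comp_as_mul, SingleObj.id_as_one, Discrete.natTrans] at h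
  have hrig : (Δ.diagram.restrict ({a : LFVertex | a.row = 1} ∪ {LFVertex.nexus})).IsTotallyRigid :=
    Δ.nexusRigidStmt_iff.mp (Δ.nexusRigidStmt_of hP hP hP)
  refine ⟨Δ, τ, two, ⟨PUnit.unit⟩, rfl, h34, hrig, ⟨Functor.FullyFaithful.id _⟩,
    fun x => Subsingleton.elim _ _, ?_⟩
  exact Δ.logFrobeniusCompatible_of τ (Functor.FullyFaithful.id _) (fun x => Subsingleton.elim _ _) two
    rfl h34 ⟨PUnit.unit⟩ hrig

end Literature.AnabelianGeometry.AbsoluteAnabelian.AbsTopIII
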